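import Literature.NumberTheory.Sieve.SmoothCEMajorArcsLemmas
import HarnessLib

/-!
# Major-arc cancellation between unit-class configurations

Topic `Literature/NumberTheory/Sieve`, namespace `Literature.NumberTheory.Sieve.SmoothArcs`; a PROVED tool file of the
circle-method engine behind [MontgomeryVaughanActa1975, §5–6] and [Harper2016, §5], sequel of
`SmoothCEMajorArcsLemmas`.

Setting.  `q` is an odd prime, `N₀ = qN₁` sample points `r/N₀` of the circle, `R` a level and `ρ` a radius with
`2ρR² < 1`, so that the major arcs `arc(k, a) = {r < N₀ : ‖r/N₀ − a/k‖ ≤ ρ}` (`1 ≤ k ≤ R`, `a < k`, `(k, a) = 1`,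
`‖·‖ = distInt`) are disjoint with union the MAJOR SET
`{r < N₀ : ∃ k ∈ [1, R], ∃ a < k, (k, a) = 1, ‖r/N₀ − a/k‖ ≤ ρ}` (`sum_filter_major_eq_sum_arcs`).  Three exponential
sums are sampled at the major points: `V₁ c r`, `V₂ c r` (depending on a unit class `c (mod 2q)`) and `V₃ r`; they
are ABSTRACT here — in the application `V_i c r = Σ_{n friable, n ≡ c (2q)} e(d_i n r/N₀)`.  On `arc(k, a)` each is
approximated by a PRINCIPAL PART in `classWeightedSum` form with gcd-weights `P_i k a r : ℕ → ℂ` (abstract as well; in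
the application they depend on `(k, β)`, `β = r/N₀ − a/k`) and frequencies `D₁q^v a`, `D₂a`, `D₃a` (`v ≥ 1`, `q ∤ D₂`;
third modulus `m₃` with `q ∤ m₃`, class `r₃`):
`‖V₁ c r − classWeightedSum (P₁ k a r) (2q) c k (D₁q^v a)‖ ≤ E₁`, `‖V₂ c r − classWeightedSum (P₂ k a r) (2q) c k (D₂a)‖ ≤ E₂`,
`‖V₃ r − classWeightedSum (P₃ k a r) m₃ r₃ k (D₃a)‖ ≤ E₃`, with `‖P-part₁‖ ≤ B₁`, `‖V₂‖, ‖P-part₂‖ ≤ B₂`, `‖V₃‖ ≤ B₃`.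

* `ce_major_principal_eq` (EXACT CANCELLATION OF THE PRINCIPAL PARTS): if the weights are OFFSET INVARIANT,
  `P_i k ((a + i·k/q) mod k) ((r + iN₁) mod N₀) = P_i k a r` whenever `q ∣ k` (the shift preserves `β` mod `1`), then
  `Σ_{k ≤ R} Σ_{(a,k)=1} Σ_{r ∈ arc(k,a)} CWS₁(c₁)·CWS₂(c₂)·conj CWS₃` is the same for any two unit-class configurations
  `(c₁, c₂)`, `(c₁', c₂')` (`sum_coprime_sum_arc_principal_eq` level by level: the fibrewise class-uniformity identity
  `sum_fibre_classWeightedSum_mul_mul_eq` after a `ℤ/q`-orbit decomposition for `q ∥ k`, pointwise for `q ∤ k`, zero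
  for `q² ∣ k`);
* `card_major_eq_sum_card_arcs`, `norm_major_sum_sub_principal_le`: `#major = Σ_k Σ_a #arc(k,a)` and
  `‖Σ_{r major} V(r) − Σ_k Σ_a Σ_{r ∈ arc(k,a)} G(k,a,r)‖ ≤ #major · err` from a pointwise `‖V(r) − G(k,a,r)‖ ≤ err`;
* `ce_major_cancellation` (THE ENGINE PIECE): under the approximation hypotheses for the classes `c₁, c₁'` and
  `c₂, c₂'` and offset invariance,
  `‖Σ_{r major} V₁ c₁ r · V₂ c₂ r · conj (V₃ r) − Σ_{r major} V₁ c₁' r · V₂ c₂' r · conj (V₃ r)‖ ≤ 2 · #major · (E₁B₂B₃ + B₁E₂B₃ + B₁B₂E₃)` —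
  only the non-principal errors survive the comparison of two unit-class configurations.

## References

* H. L. Montgomery, R. C. Vaughan, Acta Arith. 27 (1975), §5–6 [MontgomeryVaughanActa1975].
* A. J. Harper, Compositio Math. 152 (2016), §5 [Harper2016].
-/

noncomputable section

open Finset Real Complex

namespace Literature.NumberTheory.Sieve

namespace SmoothArcs

open Vinogradov
open scoped Classical

/-! ### Exact cancellation of the principal parts -/

/-- **The principal major-arc totals do not depend on the unit-class configuration.** For an odd prime `q`,
`N₀ = qN₁`, `v ≥ 1`, `q ∤ D₂`, `q ∤ m₃`, any `ρ`, `R`, `D₁`, `D₃`, `r₃`, gcd-weights `P_i k a r` that are OFFSET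
INVARIANT (`P_i k ((a + i·k/q) mod k) ((r + iN₁) mod N₀) = P_i k a r` for `q ∣ k`, `1 ≤ k ≤ R`, `a < k`, `r < N₀`,
`i < q`) and unit classes `c₁, c₂, c₁', c₂' (mod 2q)`:
`Σ_{k=1}^{R} Σ_{a<k,(k,a)=1} Σ_{r<N₀, ‖r/N₀ − a/k‖ ≤ ρ} CWS(P₁ k a r)(2q, c₁, k, D₁q^v a) · CWS(P₂ k a r)(2q, c₂, k, D₂a) · conj CWS(P₃ k a r)(m₃, r₃, k, D₃a)`
equals the same expression with `(c₁', c₂')`. [folklore] -/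
theorem ce_major_principal_eq {q N₀ N₁ R v : ℕ} (hq : q.Prime) (hq2 : q ≠ 2) (hN : N₀ = q * N₁) (hv : 1 ≤ v)
    (ρ : ℝ) (D₁ : ℤ) {D₂ : ℤ} (hD₂ : ¬ (q : ℤ) ∣ D₂) (D₃ : ℤ) {m₃ : ℕ} (hm₃ : ¬ q ∣ m₃) (r₃ : ℕ)
    (P₁ P₂ P₃ : ℕ → ℕ → ℕ → ℕ → ℂ)
    (hinv : ∀ k ∈ Finset.Icc 1 R, q ∣ k → ∀ a < k, ∀ r < N₀, ∀ i < q,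
      P₁ k ((a + i * (k / q)) % k) ((r + i * N₁) % N₀) = P₁ k a r ∧
        P₂ k ((a + i * (k / q)) % k) ((r + i * N₁) % N₀) = P₂ k a r ∧
          P₃ k ((a + i * (k / q)) % k) ((r + i * N₁) % N₀) = P₃ k a r)
    {c₁ c₂ c₁' c₂' : ℕ} (hc₁ : c₁.Coprime (2 * q)) (hc₂ : c₂.Coprime (2 * q)) (hc₁' : c₁'.Coprime (2 * q))
    (hc₂' : c₂'.Coprime (2 * q)) :
    ∑ k ∈ Finset.Icc 1 R, ∑ a ∈ (Finset.range k).filter (Nat.Coprime k),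
        ∑ r ∈ (Finset.range N₀).filter (fun r : ℕ => distInt ((r : ℝ) / N₀ - (a : ℝ) / k) ≤ ρ),
          classWeightedSum (P₁ k a r) (2 * q) c₁ k (D₁ * q ^ v * a) *
            classWeightedSum (P₂ k a r) (2 * q) c₂ k (D₂ * a) *
              starRingEnd ℂ (classWeightedSum (P₃ k a r) m₃ r₃ k (D₃ * a)) =
      ∑ k ∈ Finset.Icc 1 R, ∑ a ∈ (Finset.range k).filter (Nat.Coprime k),
        ∑ r ∈ (Finset.range N₀).filter (fun r : ℕ => distInt ((r : ℝ) / N₀ - (a : ℝ) / k) ≤ ρ),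
          classWeightedSum (P₁ k a r) (2 * q) c₁' k (D₁ * q ^ v * a) *
            classWeightedSum (P₂ k a r) (2 * q) c₂' k (D₂ * a) *
              starRingEnd ℂ (classWeightedSum (P₃ k a r) m₃ r₃ k (D₃ * a)) :=
  Finset.sum_congr rfl fun k hk =>
    sum_coprime_sum_arc_principal_eq hq hq2 hN hv ρ D₁ hD₂ D₃ hm₃ r₃ (P₁ k) (P₂ k) (P₃ k) (hinv k hk)
      hc₁ hc₂ hc₁' hc₂'

/-! ### Summing a pointwise approximation over the major arcs -/

/-- **Counting the major points arc by arc**: for `2ρR² < 1`,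
`#{r < N₀ : ∃ k ≤ R, ∃ a < k, (k,a)=1, ‖r/N₀ − a/k‖ ≤ ρ} = Σ_{k=1}^{R} Σ_{a<k,(k,a)=1} #{r < N₀ : ‖r/N₀ − a/k‖ ≤ ρ}`
(the arcs are disjoint, `sum_filter_major_eq_sum_arcs`). [cite: Harper2016, §5] -/
theorem card_major_eq_sum_card_arcs {N₀ R : ℕ} {ρ : ℝ} (hR : 2 * ρ * (R : ℝ) ^ 2 < 1) :
    ((Finset.range N₀).filter (fun r : ℕ => ∃ k : ℕ, 1 ≤ k ∧ k ≤ R ∧ ∃ a : ℕ, a < k ∧ Nat.Coprime k a ∧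
        distInt ((r : ℝ) / N₀ - (a : ℝ) / k) ≤ ρ)).card =
      ∑ k ∈ Icc 1 R, ∑ a ∈ (Finset.range k).filter (Nat.Coprime k),
        ((Finset.range N₀).filter (fun r : ℕ => distInt ((r : ℝ) / N₀ - (a : ℝ) / k) ≤ ρ)).card := by
  have h := sum_filter_major_eq_sum_arcs (N₀ := N₀) hR (fun _ => (1 : ℂ))
  simp only [Finset.sum_const, nsmul_eq_mul, mul_one] at h
  exact_mod_cast h

/-- **Summing a pointwise approximation over the major arcs.** For `2ρR² < 1`, `V : ℕ → ℂ` and arc data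
`G k a r` with `‖V r − G k a r‖ ≤ err` for `1 ≤ k ≤ R`, `a < k`, `(k,a) = 1`, `r ∈ arc(k, a)`:
`‖Σ_{r major} V r − Σ_{k} Σ_{a} Σ_{r ∈ arc(k,a)} G k a r‖ ≤ #major · err`. [cite: Harper2016, §5] -/
theorem norm_major_sum_sub_principal_le {N₀ R : ℕ} {ρ err : ℝ} (hR : 2 * ρ * (R : ℝ) ^ 2 < 1) (V : ℕ → ℂ)
    (G : ℕ → ℕ → ℕ → ℂ)
    (h : ∀ k ∈ Finset.Icc 1 R, ∀ a ∈ (Finset.range k).filter (Nat.Coprime k),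
      ∀ r ∈ (Finset.range N₀).filter (fun r : ℕ => distInt ((r : ℝ) / N₀ - (a : ℝ) / k) ≤ ρ),
        ‖V r - G k a r‖ ≤ err) :
    ‖∑ r ∈ (Finset.range N₀).filter (fun r : ℕ => ∃ k : ℕ, 1 ≤ k ∧ k ≤ R ∧ ∃ a : ℕ, a < k ∧ Nat.Coprime k a ∧
          distInt ((r : ℝ) / N₀ - (a : ℝ) / k) ≤ ρ), V r -
        ∑ k ∈ Icc 1 R, ∑ a ∈ (Finset.range k).filter (Nat.Coprime k),
          ∑ r ∈ (Finset.range N₀).filter (fun r : ℕ => distInt ((r : ℝ) / N₀ - (a : ℝ) / k) ≤ ρ), G k a r‖ ≤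
      (((Finset.range N₀).filter (fun r : ℕ => ∃ k : ℕ, 1 ≤ k ∧ k ≤ R ∧ ∃ a : ℕ, a < k ∧ Nat.Coprime k a ∧
          distInt ((r : ℝ) / N₀ - (a : ℝ) / k) ≤ ρ)).card : ℝ) * err := by
  rw [sum_filter_major_eq_sum_arcs hR V, ← Finset.sum_sub_distrib, card_major_eq_sum_card_arcs hR]
  have hb : ∀ k ∈ Finset.Icc 1 R,
      ‖∑ a ∈ (Finset.range k).filter (Nat.Coprime k),
          ∑ r ∈ (Finset.range N₀).filter (fun r : ℕ => distInt ((r : ℝ) / N₀ - (a : ℝ) / k) ≤ ρ), V r -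
        ∑ a ∈ (Finset.range k).filter (Nat.Coprime k),
          ∑ r ∈ (Finset.range N₀).filter (fun r : ℕ => distInt ((r : ℝ) / N₀ - (a : ℝ) / k) ≤ ρ), G k a r‖ ≤
        ∑ a ∈ (Finset.range k).filter (Nat.Coprime k),
          ((((Finset.range N₀).filter (fun r : ℕ => distInt ((r : ℝ) / N₀ - (a : ℝ) / k) ≤ ρ)).card : ℝ) * err) := by
    intro k hk
    rw [← Finset.sum_sub_distrib]
    refine (norm_sum_le _ _).trans (Finset.sum_le_sum fun a ha => ?_)
    rw [← Finset.sum_sub_distrib]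
    refine (norm_sum_le _ _).trans ((Finset.sum_le_sum fun r hr => h k hk a ha r hr).trans (le_of_eq ?_))
    rw [Finset.sum_const, nsmul_eq_mul]
  refine (norm_sum_le _ _).trans ((Finset.sum_le_sum hb).trans (le_of_eq ?_))
  push_cast
  rw [Finset.sum_mul]
  exact Finset.sum_congr rfl fun k _ => by rw [Finset.sum_mul]

/-! ### The engine piece -/

/-- **Major-arc cancellation between two unit-class configurations.**  Let `q` be an odd prime, `N₀ = qN₁`,
`v ≥ 1`, `2ρR² < 1`, `q ∤ D₂`, `q ∤ m₃`; let `V₁ c r`, `V₂ c r`, `V₃ r` be exponential sums sampled at `r/N₀`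
and `P_i k a r` gcd-weights of their principal parts on `arc(k, a) = {r < N₀ : ‖r/N₀ − a/k‖ ≤ ρ}` such that, for
`1 ≤ k ≤ R`, `a < k`, `(k, a) = 1`, `r ∈ arc(k, a)`: `‖V₁ c r − CWS(P₁ k a r)(2q, c, k, D₁q^v a)‖ ≤ E₁` and
`‖CWS(P₁ …)‖ ≤ B₁` for `c ∈ {c₁, c₁'}`; `‖V₂ c r − CWS(P₂ k a r)(2q, c, k, D₂a)‖ ≤ E₂`, `‖V₂ c r‖ ≤ B₂`,
`‖CWS(P₂ …)‖ ≤ B₂` for `c ∈ {c₂, c₂'}`; `‖V₃ r − CWS(P₃ k a r)(m₃, r₃, k, D₃a)‖ ≤ E₃`, `‖V₃ r‖ ≤ B₃`; and OFFSET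
INVARIANCE `P_i k ((a + i·k/q) mod k) ((r + iN₁) mod N₀) = P_i k a r` (`q ∣ k`, `a < k`, `r < N₀`, `i < q`).  Then for
unit classes `c₁, c₂, c₁', c₂' (mod 2q)`, over the major set `{r < N₀ : ∃ k ∈ [1,R], ∃ a < k, (k,a)=1, ‖r/N₀ − a/k‖ ≤ ρ}`:
`‖Σ_{r major} V₁ c₁ r · V₂ c₂ r · conj (V₃ r) − Σ_{r major} V₁ c₁' r · V₂ c₂' r · conj (V₃ r)‖ ≤ 2 · #major · (E₁B₂B₃ + B₁E₂B₃ + B₁B₂E₃)`: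
the principal parts cancel EXACTLY (`ce_major_principal_eq`), the rest telescopes (`norm_triple_conj_sub_le`).
[cite: MontgomeryVaughanActa1975, §5–6] -/
theorem ce_major_cancellation {q N₀ N₁ R v : ℕ} (hq : q.Prime) (hq2 : q ≠ 2) (hN : N₀ = q * N₁) (hv : 1 ≤ v)
    {ρ : ℝ} (hR : 2 * ρ * (R : ℝ) ^ 2 < 1) (D₁ : ℤ) {D₂ : ℤ} (hD₂ : ¬ (q : ℤ) ∣ D₂) (D₃ : ℤ) {m₃ : ℕ}
    (hm₃ : ¬ q ∣ m₃) (r₃ : ℕ) (V₁ V₂ : ℕ → ℕ → ℂ) (V₃ : ℕ → ℂ) (P₁ P₂ P₃ : ℕ → ℕ → ℕ → ℕ → ℂ)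
    {E₁ E₂ E₃ B₁ B₂ B₃ : ℝ} {c₁ c₂ c₁' c₂' : ℕ} (hc₁ : c₁.Coprime (2 * q)) (hc₂ : c₂.Coprime (2 * q))
    (hc₁' : c₁'.Coprime (2 * q)) (hc₂' : c₂'.Coprime (2 * q))
    (h₁ : ∀ c ∈ ({c₁, c₁'} : Finset ℕ), ∀ k ∈ Finset.Icc 1 R, ∀ a ∈ (Finset.range k).filter (Nat.Coprime k),
      ∀ r ∈ (Finset.range N₀).filter (fun r : ℕ => distInt ((r : ℝ) / N₀ - (a : ℝ) / k) ≤ ρ),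
        ‖V₁ c r - classWeightedSum (P₁ k a r) (2 * q) c k (D₁ * q ^ v * a)‖ ≤ E₁ ∧
          ‖classWeightedSum (P₁ k a r) (2 * q) c k (D₁ * q ^ v * a)‖ ≤ B₁)
    (h₂ : ∀ c ∈ ({c₂, c₂'} : Finset ℕ), ∀ k ∈ Finset.Icc 1 R, ∀ a ∈ (Finset.range k).filter (Nat.Coprime k),
      ∀ r ∈ (Finset.range N₀).filter (fun r : ℕ => distInt ((r : ℝ) / N₀ - (a : ℝ) / k) ≤ ρ),
        ‖V₂ c r - classWeightedSum (P₂ k a r) (2 * q) c k (D₂ * a)‖ ≤ E₂ ∧ ‖V₂ c r‖ ≤ B₂ ∧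
          ‖classWeightedSum (P₂ k a r) (2 * q) c k (D₂ * a)‖ ≤ B₂)
    (h₃ : ∀ k ∈ Finset.Icc 1 R, ∀ a ∈ (Finset.range k).filter (Nat.Coprime k),
      ∀ r ∈ (Finset.range N₀).filter (fun r : ℕ => distInt ((r : ℝ) / N₀ - (a : ℝ) / k) ≤ ρ),
        ‖V₃ r - classWeightedSum (P₃ k a r) m₃ r₃ k (D₃ * a)‖ ≤ E₃ ∧ ‖V₃ r‖ ≤ B₃)
    (hinv : ∀ k ∈ Finset.Icc 1 R, q ∣ k → ∀ a < k, ∀ r < N₀, ∀ i < q,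
      P₁ k ((a + i * (k / q)) % k) ((r + i * N₁) % N₀) = P₁ k a r ∧
        P₂ k ((a + i * (k / q)) % k) ((r + i * N₁) % N₀) = P₂ k a r ∧
          P₃ k ((a + i * (k / q)) % k) ((r + i * N₁) % N₀) = P₃ k a r) :
    ‖∑ r ∈ (Finset.range N₀).filter (fun r : ℕ => ∃ k : ℕ, 1 ≤ k ∧ k ≤ R ∧ ∃ a : ℕ, a < k ∧ Nat.Coprime k a ∧
          distInt ((r : ℝ) / N₀ - (a : ℝ) / k) ≤ ρ), V₁ c₁ r * V₂ c₂ r * starRingEnd ℂ (V₃ r) -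
        ∑ r ∈ (Finset.range N₀).filter (fun r : ℕ => ∃ k : ℕ, 1 ≤ k ∧ k ≤ R ∧ ∃ a : ℕ, a < k ∧ Nat.Coprime k a ∧
          distInt ((r : ℝ) / N₀ - (a : ℝ) / k) ≤ ρ), V₁ c₁' r * V₂ c₂' r * starRingEnd ℂ (V₃ r)‖ ≤
      2 * (((Finset.range N₀).filter (fun r : ℕ => ∃ k : ℕ, 1 ≤ k ∧ k ≤ R ∧ ∃ a : ℕ, a < k ∧ Nat.Coprime k a ∧
          distInt ((r : ℝ) / N₀ - (a : ℝ) / k) ≤ ρ)).card : ℝ) * (E₁ * B₂ * B₃ + B₁ * E₂ * B₃ + B₁ * B₂ * E₃) := by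
  -- the principal products of a configuration `(s₁, s₂)`
  set G : ℕ → ℕ → ℕ → ℕ → ℕ → ℂ := fun s₁ s₂ k a r =>
    classWeightedSum (P₁ k a r) (2 * q) s₁ k (D₁ * q ^ v * a) * classWeightedSum (P₂ k a r) (2 * q) s₂ k (D₂ * a) *
      starRingEnd ℂ (classWeightedSum (P₃ k a r) m₃ r₃ k (D₃ * a)) with hG
  -- their totals agree
  have hprin : ∑ k ∈ Finset.Icc 1 R, ∑ a ∈ (Finset.range k).filter (Nat.Coprime k),
      ∑ r ∈ (Finset.range N₀).filter (fun r : ℕ => distInt ((r : ℝ) / N₀ - (a : ℝ) / k) ≤ ρ), G c₁ c₂ k a r =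
      ∑ k ∈ Finset.Icc 1 R, ∑ a ∈ (Finset.range k).filter (Nat.Coprime k),
        ∑ r ∈ (Finset.range N₀).filter (fun r : ℕ => distInt ((r : ℝ) / N₀ - (a : ℝ) / k) ≤ ρ), G c₁' c₂' k a r :=
    ce_major_principal_eq hq hq2 hN hv ρ D₁ hD₂ D₃ hm₃ r₃ P₁ P₂ P₃ hinv hc₁ hc₂ hc₁' hc₂'
  -- each configuration is within `#major · err` of its principal total
  have happ : ∀ {s₁ s₂ : ℕ}, s₁ ∈ ({c₁, c₁'} : Finset ℕ) → s₂ ∈ ({c₂, c₂'} : Finset ℕ) →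
      ‖∑ r ∈ (Finset.range N₀).filter (fun r : ℕ => ∃ k : ℕ, 1 ≤ k ∧ k ≤ R ∧ ∃ a : ℕ, a < k ∧ Nat.Coprime k a ∧
            distInt ((r : ℝ) / N₀ - (a : ℝ) / k) ≤ ρ), V₁ s₁ r * V₂ s₂ r * starRingEnd ℂ (V₃ r) -
          ∑ k ∈ Icc 1 R, ∑ a ∈ (Finset.range k).filter (Nat.Coprime k),
            ∑ r ∈ (Finset.range N₀).filter (fun r : ℕ => distInt ((r : ℝ) / N₀ - (a : ℝ) / k) ≤ ρ), G s₁ s₂ k a r‖ ≤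
        (((Finset.range N₀).filter (fun r : ℕ => ∃ k : ℕ, 1 ≤ k ∧ k ≤ R ∧ ∃ a : ℕ, a < k ∧ Nat.Coprime k a ∧
            distInt ((r : ℝ) / N₀ - (a : ℝ) / k) ≤ ρ)).card : ℝ) * (E₁ * B₂ * B₃ + B₁ * E₂ * B₃ + B₁ * B₂ * E₃) := by
    intro s₁ s₂ hs₁ hs₂
    refine norm_major_sum_sub_principal_le hR (fun r => V₁ s₁ r * V₂ s₂ r * starRingEnd ℂ (V₃ r)) (G s₁ s₂)
      fun k hk a ha r hr => ?_
    obtain ⟨e₁, b₁⟩ := h₁ s₁ hs₁ k hk a ha r hr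
    obtain ⟨e₂, b₂, b₂'⟩ := h₂ s₂ hs₂ k hk a ha r hr
    obtain ⟨e₃, b₃⟩ := h₃ k hk a ha r hr
    exact norm_triple_conj_sub_le e₁ e₂ e₃ b₁ b₂ b₂' b₃
  have e₁ := happ (Finset.mem_insert_self c₁ {c₁'}) (Finset.mem_insert_self c₂ {c₂'})
  have e₂ := happ (Finset.mem_insert_of_mem (Finset.mem_singleton_self c₁'))
    (Finset.mem_insert_of_mem (Finset.mem_singleton_self c₂'))
  rw [← hprin] at e₂
  have key : ∀ (A B P : ℂ), A - B = (A - P) - (B - P) := fun A B P => by ring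
  rw [key _ _ (∑ k ∈ Finset.Icc 1 R, ∑ a ∈ (Finset.range k).filter (Nat.Coprime k),
      ∑ r ∈ (Finset.range N₀).filter (fun r : ℕ => distInt ((r : ℝ) / N₀ - (a : ℝ) / k) ≤ ρ), G c₁ c₂ k a r)]
  refine (norm_sub_le _ _).trans ?_
  linarith

end SmoothArcs

end Literature.NumberTheory.Sieve

end
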